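import Summits.ResolutionOfSingularities.ResolutionOfSingularities.Theorems.PurelyInseparableDim4WildConesGapSpecimen
import HarnessLib
import HarnessLib.Audit.Tags

/-!
# Purely inseparable four-folds — the BAND specimen of «`J₃⁺`-isolated but Milnor-infinite»
# (bridge WildCones ↔ `PIDim4`, census values; cell `res-dim4-pi`, p-12, width 12)

[OURS · counted 0 · worked instance only; nothing here is a statement about resolution of
singularities.]

Companion of `…WildConesGapSpecimen` (floor specimen `x₁x₂x₃ + x₄⁴` and the test
`not_milnorFinite_of_coeff_single_pderiv_eq_zero`).  Here the band state (`ord G = 4 > 3 = q`)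
`G = x₁²x₂² + x₃⁴ + x₄⁴` over a field of characteristic `3`:

* `J₃⁺(G) ∋ D^{(2e₁)}G = x₂², D^{(2e₂)}G = x₁², D^{(e₃)}G = 4x₃³ = x₃³, D^{(e₄)}G = x₄³`, hence
  `𝔪₀⁷ ≤ J₃⁺(G) ≤ 𝔪₀` and the origin is an ISOLATED triple point of `z³ + G`
  (`isIsolated_three_bandSpecimen`, certificate `IsolationCert.isIsolated_of_pow_le`, `N = 7`);
* `∂G = (2x₁x₂², 2x₁²x₂, 4x₃³, 4x₄³)` vanishes on the `x₁`-axis, so the formal Milnor algebra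
  `K⟦x⟧ ⧸ ⟨∂ᵢ ↑G⟩` is INFINITE (`not_milnorFinite_bandSpecimen`, any characteristic).

So the sub-regime of `F4-I(3,3)` not covered by the WildCones bridge (`J₃⁺`-isolated, gradient
ideal not `𝔪̂`-primary) meets the band `ord F = q + 1` as well as the floor.  Nothing here proves
`NoIsolatedTrap 3 3` or resolution of singularities in dimension ≥ 4 / characteristic `p`.
bears_on: LADDER-RESOLUTION:D157-DOOR2 (res-dim4-pi · F4-I(3,3) census).
Supports stmt-ResolutionOfSingularities-16155 (helper).
-/

set_option linter.dupNamespace false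

noncomputable section

namespace Summit.ResolutionOfSingularities.ResolutionOfSingularities.Theorems.PIDim4

namespace WildConesBridge

open MvPolynomial Finset IsLocalRing
open Literature.AlgebraicGeometry.Resolution

variable {K : Type} [Field K]

/-! ## The band specimen `G = x₁²x₂² + x₃⁴ + x₄⁴` at `p = 3` -/

/-- `x₁²x₂² + x₃⁴ + x₄⁴` as a sum of three monomials. [folklore] -/
theorem bandSpecimen_eq :
    (X 0 ^ 2 * X 1 ^ 2 + X 2 ^ 4 + X 3 ^ 4 : MvPolynomial (Fin 4) K) =
      monomial (Finsupp.single 0 2 + Finsupp.single 1 2) 1 + monomial (Finsupp.single 2 4) 1 +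
        monomial (Finsupp.single 3 4) 1 := by
  rw [X_pow_eq_monomial, X_pow_eq_monomial, X_pow_eq_monomial, X_pow_eq_monomial, monomial_mul,
    mul_one]

/-- An exponent with a positive coordinate off `0` is not a pure power of `x₁`. [folklore] -/
theorem ne_single_zero_of_apply_pos {e : Fin 4 →₀ ℕ} {c : Fin 4} (hc : c ≠ 0) (h : 0 < e c) (n : ℕ) :
    e ≠ Finsupp.single 0 n := by
  intro h'
  rw [h', Finsupp.single_eq_of_ne hc] at h
  exact lt_irrefl 0 h

/-- `D^{(2eₐ)}(xₐ² x_b²) = x_b²` (`a ≠ b`; binomials `C(2,2) = C(2,0) = 1`). [folklore] -/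
theorem hasseDeriv_single_two_sq_mul_sq {a b : Fin 4} (hab : a ≠ b) :
    hasseDeriv (Finsupp.single a 2) (monomial (Finsupp.single a 2 + Finsupp.single b 2) (1 : K)) =
      monomial (Finsupp.single b 2) 1 := by
  have hle : Finsupp.single a 2 ≤ Finsupp.single a 2 + Finsupp.single b 2 := self_le_add_right _ _
  rw [UniformTrapScope.hasseDeriv_monomial' _ _ 1 hle, mul_one, add_tsub_cancel_left]
  congr 1
  refine Finset.prod_eq_one fun i _ => ?_
  by_cases hia : i = a
  · subst hia
    rw [Finsupp.add_apply, Finsupp.single_eq_same, Finsupp.single_eq_of_ne hab, add_zero,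
      Nat.choose_self, Nat.cast_one]
  · rw [Finsupp.single_eq_of_ne hia, Nat.choose_zero_right, Nat.cast_one]

/-- The members `x₂² = D^{(2e₁)}G` and `x₁² = D^{(2e₂)}G` of `J₃⁺(x₁²x₂² + x₃⁴ + x₄⁴)`:
for `{a, b} = {0, 1}`, `D^{(2eₐ)}G = x_b²`. [folklore] -/
theorem hasseDeriv_bandSpecimen_single_two {a b : Fin 4} (hab : a ≠ b)
    (h : Finsupp.single (0 : Fin 4) 2 + Finsupp.single 1 2 = Finsupp.single a 2 + Finsupp.single b 2)
    (ha2 : a ≠ 2) (ha3 : a ≠ 3) :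
    hasseDeriv (Finsupp.single a 2) (X 0 ^ 2 * X 1 ^ 2 + X 2 ^ 4 + X 3 ^ 4 : MvPolynomial (Fin 4) K) =
      monomial (Finsupp.single b 2) 1 := by
  have hn2 : ¬ Finsupp.single a 2 ≤ Finsupp.single (2 : Fin 4) 4 := fun hle => by
    have h1 := hle a
    rw [Finsupp.single_eq_same, Finsupp.single_eq_of_ne ha2] at h1
    omega
  have hn3 : ¬ Finsupp.single a 2 ≤ Finsupp.single (3 : Fin 4) 4 := fun hle => by
    have h1 := hle a
    rw [Finsupp.single_eq_same, Finsupp.single_eq_of_ne ha3] at h1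
    omega
  rw [bandSpecimen_eq, IsolatedBand.hasseDeriv_add, IsolatedBand.hasseDeriv_add, h,
    hasseDeriv_single_two_sq_mul_sq hab, hasseDeriv_monomial_of_not_le _ hn2,
    hasseDeriv_monomial_of_not_le _ hn3, add_zero, add_zero]

/-- The members `x₃³ = D^{(e₃)}G`, `x₄³ = D^{(e₄)}G` of `J₃⁺(x₁²x₂² + x₃⁴ + x₄⁴)` in characteristic `3`.
[folklore] -/
theorem hasseDeriv_bandSpecimen_single_one [CharP K 3] {j : Fin 4} (hj0 : j ≠ 0) (hj1 : j ≠ 1) :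
    hasseDeriv (Finsupp.single j 1) (X 0 ^ 2 * X 1 ^ 2 + X 2 ^ 4 + X 3 ^ 4 : MvPolynomial (Fin 4) K) =
      monomial (Finsupp.single j 3) 1 := by
  have hn : ¬ Finsupp.single j 1 ≤ Finsupp.single (0 : Fin 4) 2 + Finsupp.single 1 2 := fun hle => by
    have h1 := hle j
    rw [Finsupp.single_eq_same, Finsupp.add_apply, Finsupp.single_eq_of_ne hj0,
      Finsupp.single_eq_of_ne hj1] at h1
    omega
  have hother : ∀ k : Fin 4, k ≠ j →
      hasseDeriv (Finsupp.single j 1) (monomial (Finsupp.single k 4) (1 : K)) = 0 := fun k hk =>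
    hasseDeriv_monomial_of_not_le _ fun hle => by
      have h1 := hle j
      rw [Finsupp.single_eq_same, Finsupp.single_eq_of_ne (Ne.symm hk)] at h1
      omega
  rw [bandSpecimen_eq, IsolatedBand.hasseDeriv_add, IsolatedBand.hasseDeriv_add,
    hasseDeriv_monomial_of_not_le _ hn, zero_add]
  have hj : j = 2 ∨ j = 3 := by
    fin_cases j <;> simp at hj0 hj1 ⊢
  rcases hj with rfl | rfl
  · rw [hasseDeriv_single_X_pow_four, hother 3 (by decide), add_zero]
  · rw [hasseDeriv_single_X_pow_four, hother 2 (by decide), zero_add]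

/-- **`J₃⁺(x₁²x₂² + x₃⁴ + x₄⁴) ∋ x₁², x₂²` (as monomials).** [folklore] -/
theorem monomial_two_mem_singLocusIdeal_bandSpecimen {b : Fin 4} (hb : b = 0 ∨ b = 1) :
    monomial (Finsupp.single b 2) (1 : K) ∈
      singLocusIdeal 3 (X 0 ^ 2 * X 1 ^ 2 + X 2 ^ 4 + X 3 ^ 4 : MvPolynomial (Fin 4) K) := by
  -- `a` := the other index of `{0, 1}`
  obtain ⟨a, hab, h, ha2, ha3⟩ : ∃ a : Fin 4, a ≠ b ∧
      Finsupp.single (0 : Fin 4) 2 + Finsupp.single 1 2 = Finsupp.single a 2 + Finsupp.single b 2 ∧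
      a ≠ 2 ∧ a ≠ 3 := by
    rcases hb with rfl | rfl
    · exact ⟨1, by decide, add_comm _ _, by decide, by decide⟩
    · exact ⟨0, by decide, rfl, by decide, by decide⟩
  rw [← hasseDeriv_bandSpecimen_single_two hab h ha2 ha3]
  exact Ideal.subset_span ⟨Finsupp.single a 2, by rw [Finsupp.degree_single]; norm_num,
    by rw [Finsupp.degree_single]; norm_num, rfl⟩

/-- **`J₃⁺(x₁²x₂² + x₃⁴ + x₄⁴) ∋ x₃³, x₄³`** in characteristic `3` (as monomials). [folklore] -/
theorem monomial_three_mem_singLocusIdeal_bandSpecimen [CharP K 3] {j : Fin 4} (hj0 : j ≠ 0)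
    (hj1 : j ≠ 1) :
    monomial (Finsupp.single j 3) (1 : K) ∈
      singLocusIdeal 3 (X 0 ^ 2 * X 1 ^ 2 + X 2 ^ 4 + X 3 ^ 4 : MvPolynomial (Fin 4) K) := by
  rw [← hasseDeriv_bandSpecimen_single_one hj0 hj1]
  exact Ideal.subset_span ⟨Finsupp.single j 1, by rw [Finsupp.degree_single]; norm_num,
    by rw [Finsupp.degree_single]; norm_num, rfl⟩

/-- **The band specimen is `J₃⁺`-ISOLATED**: over a field of characteristic `3`, the origin is an
isolated triple point of `z³ + x₁²x₂² + x₃⁴ + x₄⁴` (order `4`: a band state) in the sense of the frame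
(`𝔪₀⁷ ≤ J₃⁺(G) ≤ 𝔪₀`, certificate with `N = 7`). OURS (worked instance). [folklore] -/
theorem isIsolated_three_bandSpecimen [CharP K 3] :
    IsIsolated 3 (X 0 ^ 2 * X 1 ^ 2 + X 2 ^ 4 + X 3 ^ 4 : MvPolynomial (Fin 4) K) := by
  classical
  refine IsolationCert.isIsolated_of_pow_le (N := 7) ?_ ?_
  · -- `J₃⁺(G) ≤ 𝔪₀`: `G` has no monomial of degree `1` or `2`
    rw [IsolatedScope.singLocusIdeal_le_originIdeal_iff]
    intro α _ hq
    have h1 : ¬ (Finsupp.single (0 : Fin 4) 2 + Finsupp.single 1 2 = α) := by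
      intro h
      rw [← h, map_add, Finsupp.degree_single, Finsupp.degree_single] at hq
      omega
    have h2 : ¬ (Finsupp.single (2 : Fin 4) 4 = α) := by
      intro h; rw [← h, Finsupp.degree_single] at hq; omega
    have h3 : ¬ (Finsupp.single (3 : Fin 4) 4 = α) := by
      intro h; rw [← h, Finsupp.degree_single] at hq; omega
    rw [bandSpecimen_eq, coeff_add, coeff_add, coeff_monomial, coeff_monomial, coeff_monomial,
      if_neg h1, if_neg h2, if_neg h3, add_zero, add_zero]
  · -- `𝔪₀⁷ ≤ J₃⁺(G)`: a degree-7 monomial is divisible by `x₁²`, `x₂²`, `x₃³` or `x₄³`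
    conv_lhs => rw [IsolationCert.originIdeal_eq_idealOfVars, MvPolynomial.pow_idealOfVars_eq_span]
    rw [Ideal.span_le]
    rintro _ ⟨γ, hγ, rfl⟩
    show monomial γ (1 : K) ∈ singLocusIdeal 3 _
    have hγ7 : γ.degree = 7 := hγ
    have hsum : γ.degree = γ 0 + γ 1 + γ 2 + γ 3 := by
      rw [Finsupp.degree_eq_sum, Fin.sum_univ_four]
    by_cases h0 : 2 ≤ γ 0
    · exact monomial_mem_of_le_of_mem (Finsupp.single_le_iff.mpr h0)
        (monomial_two_mem_singLocusIdeal_bandSpecimen (Or.inl rfl))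
    by_cases h1 : 2 ≤ γ 1
    · exact monomial_mem_of_le_of_mem (Finsupp.single_le_iff.mpr h1)
        (monomial_two_mem_singLocusIdeal_bandSpecimen (Or.inr rfl))
    by_cases h2 : 3 ≤ γ 2
    · exact monomial_mem_of_le_of_mem (Finsupp.single_le_iff.mpr h2)
        (monomial_three_mem_singLocusIdeal_bandSpecimen (by decide) (by decide))
    have h3 : 3 ≤ γ 3 := by omega
    exact monomial_mem_of_le_of_mem (Finsupp.single_le_iff.mpr h3)
      (monomial_three_mem_singLocusIdeal_bandSpecimen (by decide) (by decide))

/-- **The band specimen is MILNOR-INFINITE**: `∂G = (2x₁x₂², 2x₁²x₂, 4x₃³, 4x₄³)` vanishes on the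
`x₁`-axis, so `K⟦x⟧ ⧸ ⟨∂ᵢ ↑G⟩` is not finite over `K` (any characteristic). OURS (worked instance).
[folklore] -/
theorem not_milnorFinite_bandSpecimen :
    ¬ Module.Finite K (MvPowerSeries (Fin 4) K ⧸ Ideal.span (Set.range fun t : Fin 4 =>
      MvPowerSeries.pderiv t ((X 0 ^ 2 * X 1 ^ 2 + X 2 ^ 4 + X 3 ^ 4 : MvPolynomial (Fin 4) K) :
        MvPowerSeries (Fin 4) K))) := by
  classical
  refine not_milnorFinite_of_coeff_single_pderiv_eq_zero 0 fun t n => ?_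
  -- every monomial of `∂ₜG` has a positive coordinate at `1`, `2` or `3`
  have hpos : ∀ (d : Fin 4 →₀ ℕ) (c : Fin 4), c ≠ 0 → 2 ≤ d c →
      d - Finsupp.single t 1 ≠ Finsupp.single 0 n := fun d c hc hdc =>
    ne_single_zero_of_apply_pos hc (by
      rw [Finsupp.tsub_apply, Finsupp.single_apply]
      split_ifs <;> omega) n
  have h1 := hpos (Finsupp.single 0 2 + Finsupp.single 1 2) 1 (by decide)
    (by rw [Finsupp.add_apply, Finsupp.single_eq_same, Finsupp.single_eq_of_ne (by decide)])
  have h2 := hpos (Finsupp.single 2 4) 2 (by decide) (by rw [Finsupp.single_eq_same]; norm_num)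
  have h3 := hpos (Finsupp.single 3 4) 3 (by decide) (by rw [Finsupp.single_eq_same]; norm_num)
  rw [bandSpecimen_eq, map_add, map_add, pderiv_monomial, pderiv_monomial, pderiv_monomial, coeff_add,
    coeff_add, coeff_monomial, coeff_monomial, coeff_monomial, if_neg h1, if_neg h2, if_neg h3, add_zero,
    add_zero]

end WildConesBridge

end Summit.ResolutionOfSingularities.ResolutionOfSingularities.Theorems.PIDim4

end
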